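import Mathlib

/-!
# T5DenseFiniteDim — a dense submodule of a finite-dimensional normed space is the whole space; projector form

Kernel witness (pub-hodge-repro2, Tier 5, support memo route/T5-CHECK-N1-p6.md, note n1) for the
one-line density step that closes the span-versus-closure gap of N1's ID-3(c)–(d) for the vectors
actually used there: if `Θ` (the span of the theta lifts) is dense in the irreducible unitary
representation `Π`, and `e = e_τ e_K` is a continuous projector with finite-dimensional range
(admissibility) that preserves `Θ`, then every `e`-fixed vector of `Π` (a `K`-fixed vector of
`K₁`-type `τ`) already lies in `Θ`.  Everything below is abstract linear topology over a complete
nontrivially normed field; nothing automorphic is formalised.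
-/

namespace Summit.Ventures.HodgeRepro2.T5DenseFiniteDim

variable {𝕜 E : Type*} [NontriviallyNormedField 𝕜] [CompleteSpace 𝕜]
  [NormedAddCommGroup E] [NormedSpace 𝕜 E]

/-- A dense submodule of a finite-dimensional normed space over a complete field is the whole
space (a finite-dimensional subspace is closed, so it equals its closure). -/
theorem Submodule.eq_top_of_dense [FiniteDimensional 𝕜 E] (M : Submodule 𝕜 E)
    (hM : Dense (M : Set E)) : M = ⊤ := by
  have hclosed : IsClosed (M : Set E) := Submodule.closed_of_finiteDimensional M
  have huniv : (M : Set E) = Set.univ := by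
    rw [← hclosed.closure_eq]
    exact hM.closure_eq
  exact Submodule.eq_top_iff'.mpr (fun x => by
    have : x ∈ (M : Set E) := by rw [huniv]; exact Set.mem_univ x
    exact this)

/-- Image of a dense submodule under a continuous linear map with finite-dimensional range:
the image is the whole range (it is dense in the range and finite-dimensional, hence closed). -/
theorem Submodule.map_eq_range_of_dense (e : E →L[𝕜] E)
    [FiniteDimensional 𝕜 (LinearMap.range (e : E →ₗ[𝕜] E))] (M : Submodule 𝕜 E)
    (hM : Dense (M : Set E)) :
    M.map (e : E →ₗ[𝕜] E) = LinearMap.range (e : E →ₗ[𝕜] E) := by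
  have hle : M.map (e : E →ₗ[𝕜] E) ≤ LinearMap.range (e : E →ₗ[𝕜] E) := LinearMap.map_le_range
  haveI : FiniteDimensional 𝕜 (M.map (e : E →ₗ[𝕜] E)) := Submodule.finiteDimensional_of_le hle
  have hclosed : IsClosed ((M.map (e : E →ₗ[𝕜] E) : Submodule 𝕜 E) : Set E) :=
    Submodule.closed_of_finiteDimensional _
  refine le_antisymm hle ?_
  rintro y ⟨x, rfl⟩
  have hx : x ∈ closure (M : Set E) := by rw [hM.closure_eq]; exact Set.mem_univ x
  have himg : e x ∈ closure (e '' (M : Set E)) :=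
    image_closure_subset_closure_image e.continuous ⟨x, hx, rfl⟩
  have hset : (e '' (M : Set E)) = ((M.map (e : E →ₗ[𝕜] E) : Submodule 𝕜 E) : Set E) := by
    ext z; simp
  rw [hset, hclosed.closure_eq] at himg
  exact himg

/-- Projector form: `e` continuous linear with finite-dimensional range, `M` dense and stable
under `e`; then every `e`-fixed vector lies in `M`. (Read `e = e_τ e_K`, `M = Θ`, `E = Π`.) -/
theorem mem_of_dense_of_map_le (e : E →L[𝕜] E)
    [FiniteDimensional 𝕜 (LinearMap.range (e : E →ₗ[𝕜] E))] (M : Submodule 𝕜 E)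
    (hM : Dense (M : Set E)) (hstab : M.map (e : E →ₗ[𝕜] E) ≤ M) {v : E} (hv : e v = v) :
    v ∈ M := by
  have hv' : v ∈ LinearMap.range (e : E →ₗ[𝕜] E) := ⟨v, hv⟩
  rw [← Submodule.map_eq_range_of_dense e M hM] at hv'
  exact hstab hv'

omit [CompleteSpace 𝕜] in
/-- The range of an idempotent is exactly its fixed-point set (used to read `range e` as
«the `K`-fixed vectors of `K₁`-type `τ`» once `e = e_τ e_K` is idempotent). -/
theorem mem_range_iff_fixed (e : E →L[𝕜] E) (hidem : ∀ x, e (e x) = e x) {v : E} :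
    v ∈ LinearMap.range (e : E →ₗ[𝕜] E) ↔ e v = v := by
  constructor
  · rintro ⟨x, rfl⟩
    exact hidem x
  · intro hv
    exact ⟨v, hv⟩

/-- Combined statement: for an idempotent continuous projector with finite-dimensional range and a
dense `e`-stable submodule `M`, the `e`-fixed vectors of `M` are ALL the `e`-fixed vectors. -/
theorem fixed_subset_of_dense (e : E →L[𝕜] E)
    [FiniteDimensional 𝕜 (LinearMap.range (e : E →ₗ[𝕜] E))] (M : Submodule 𝕜 E)
    (hM : Dense (M : Set E)) (hstab : M.map (e : E →ₗ[𝕜] E) ≤ M) :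
    {v : E | e v = v} ⊆ (M : Set E) := fun _ hv => mem_of_dense_of_map_le e M hM hstab hv

end Summit.Ventures.HodgeRepro2.T5DenseFiniteDim
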